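import Literature.Probability.Percolation.BergKahnLogSupermodular
import HarnessLib

/-!
# van den Berg–Kahn (2001), Theorem 1.1 for vertex SETS (their Remark 3): given that `S` is not joined to `T`, the events
# `S ↔ A` and `S ↔ B` are positively correlated

Topic `Literature/Probability/Percolation`; a leaf companion of `BergKahnLogSupermodular.lean` (which proves van den Berg–Kahn's
Theorem 1.2, Theorem 1.1 for a single root `s` — `BergKahn.bergKahn_thm_1_1` — and the root-set avoidance form of their Remark 3,
`BergKahn.bergKahn_groupAvoidance`).  Bernoulli bond percolation `prodBernoulli w` with arbitrary edge probabilities on a finite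
vertex type; `X ↔ Y` means: some vertex of `X` is joined to some vertex of `Y` by an open path; `X ↛ Y` is its negation.

## Source, as printed

[VandenbergKahn2001, Thm. 1.1, p. 123]: «THEOREM 1.1. For any `s, a, b, t ∈ V`,
`P(s ↔ a, s ↔ b | s ↮ t) ≥ P(s ↔ a | s ↮ t) P(s ↔ b | s ↮ t)`.»
[VandenbergKahn2001, Remark 3, p. 124]: «As pointed out to us by the referee, Theorem 1.1 can be generalized to sets of vertices
`S, A, B, T` by replacing `s` by `S, …, t` by `T`, and interpreting `X ↔ Y` as `{∃ x ∈ X, y ∈ Y, x ↔ y}`.  To see this, simply identify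
all vertices in each of `S, A, B, T`, retaining multiple edges, and apply Theorem 1.1.»

## What is formalized (theorems only; no definitions, no named facts)

* `BergKahn.bergKahn_thm_1_1_sets` — the Remark-3 form for a finite root set `S` and arbitrary vertex sets `A, B, T`, multiplied out:
  `P(S↛T, S↔A)·P(S↛T, S↔B) ≤ P(S↛T, S↔A, S↔B)·P(S↛T)`.
  PROOF (theirs, Remark 1 route, in avoidance form — no vertex identification needed): with `D_X = {S ↛ X}`, the map `X ↦ P(D_X)` is
  log-supermodular (`bergKahn_groupAvoidance`, = Thm 1.2 with `A = B = ∅` for a root set); apply it to `X = T ∪ A`, `Y = T ∪ B`, bound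
  `P(D_{(T∪A)∩(T∪B)}) ≤ P(D_T)` (avoidance is antitone in the avoided set), and rewrite `{S↛T, S↔A} = D_T ∖ D_A` etc. by
  inclusion–exclusion.
* SPECIALISATION (not re-declared here, to avoid a duplicate statement in the tree): with `A = {x}`, `B = {y}`, `T = {t}`,
  `by simpa only [Set.mem_singleton_iff, forall_eq, exists_eq_left] using bergKahn_thm_1_1_sets w S {x} {y} {t}` is, verbatim,
  the root-set Theorem 1.1 `μ(D ∩ A_x)·μ(D ∩ A_y) ≤ μ(D ∩ A_x ∩ A_y)·μ(D)` (`D = {S ↛ t}`, `A_v = {S ↔ v}`) that the `CriticalPhenomena`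
  cell uses as "attachment correlation given port isolation" (`PortAttachmentCorrelation.attach_posCorr_given_groupIso` in
  `Summits/CriticalPhenomena/PercolationContinuityZ3/Theorems/PercNearOneGluingNoHeavyLowerTailPortAttachmentCorrelation.lean`);
  for `S = {s}` it is Theorem 1.1 itself (`bergKahn_thm_1_1` in `BergKahnLogSupermodular.lean`).
-/

noncomputable section

namespace Literature.Probability.Percolation.BergKahn

open MeasureTheory Set Literature.Probability.LatticeModels
open scoped Classical

variable {V : Type} [Fintype V] [DecidableEq V]

/-- Inclusion–exclusion arithmetic: `px·py ≤ d·z ⟹ (d − px)(d − py) ≤ (d − px − py + z)·d`. [folklore] -/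
private theorem ie_step {d px py z : ℝ} (h : px * py ≤ d * z) : (d - px) * (d - py) ≤ (d - px - py + z) * d := by
  have e : (d - px - py + z) * d - (d - px) * (d - py) = d * z - px * py := by ring
  linarith

/-- **van den Berg–Kahn 2001, Theorem 1.1 for vertex sets (their Remark 3).**  For Bernoulli bond percolation `prodBernoulli w` on a
finite vertex type, a finite root set `S` and vertex sets `A, B, T`, writing `S ↛ T` for "no `s ∈ S` is joined to a `t ∈ T` by an open
path" and `S ↔ A` for "some `s ∈ S` is joined to some `a ∈ A`":
`P(S↛T, S↔A) · P(S↛T, S↔B) ≤ P(S↛T, S↔A, S↔B) · P(S↛T)`,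
i.e. conditionally on `{S ↛ T}` the events `{S ↔ A}`, `{S ↔ B}` are positively correlated.
[cite: VandenbergKahn2001, Thm 1.1 (p. 123) and Remark 3 (p. 124)] -/
theorem bergKahn_thm_1_1_sets (w : Sym2 V → unitInterval) (S : Finset V) (A B T : Set V) :
    (prodBernoulli w).real {ω : BondConfig V | (∀ s ∈ S, ∀ t ∈ T, ω ∉ openConn s t) ∧ ∃ s ∈ S, ∃ a ∈ A, ω ∈ openConn s a} *
        (prodBernoulli w).real {ω : BondConfig V | (∀ s ∈ S, ∀ t ∈ T, ω ∉ openConn s t) ∧ ∃ s ∈ S, ∃ b ∈ B, ω ∈ openConn s b} ≤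
      (prodBernoulli w).real {ω : BondConfig V | (∀ s ∈ S, ∀ t ∈ T, ω ∉ openConn s t) ∧ (∃ s ∈ S, ∃ a ∈ A, ω ∈ openConn s a) ∧
            ∃ s ∈ S, ∃ b ∈ B, ω ∈ openConn s b} *
        (prodBernoulli w).real {ω : BondConfig V | ∀ s ∈ S, ∀ t ∈ T, ω ∉ openConn s t} := by
  set μ := prodBernoulli w with hμ
  -- avoidance events `D_X = {S ↛ X}`
  set D : Set (BondConfig V) := {ω | ∀ s ∈ S, ∀ t ∈ T, ω ∉ openConn s t} with hD
  set RA : Set (BondConfig V) := {ω | ∀ s ∈ S, ∀ a ∈ A, ω ∉ openConn s a} with hRA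
  set RB : Set (BondConfig V) := {ω | ∀ s ∈ S, ∀ b ∈ B, ω ∉ openConn s b} with hRB
  -- van den Berg–Kahn's log-supermodularity of group avoidance at `X = T ∪ A`, `Y = T ∪ B`
  have hBK := bergKahn_groupAvoidance w S (T ∪ A) (T ∪ B)
  have eX : {ω : BondConfig V | ∀ s ∈ S, ∀ z ∈ T ∪ A, ω ∉ openConn s z} = D ∩ RA := by
    ext ω
    simp only [mem_setOf_eq, mem_inter_iff, mem_union, hD, hRA]
    constructor
    · intro h
      exact ⟨fun s hs t ht => h s hs t (Or.inl ht), fun s hs a ha => h s hs a (Or.inr ha)⟩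
    · rintro ⟨h1, h2⟩ s hs z hz
      rcases hz with hz | hz
      exacts [h1 s hs z hz, h2 s hs z hz]
  have eY : {ω : BondConfig V | ∀ s ∈ S, ∀ z ∈ T ∪ B, ω ∉ openConn s z} = D ∩ RB := by
    ext ω
    simp only [mem_setOf_eq, mem_inter_iff, mem_union, hD, hRB]
    constructor
    · intro h
      exact ⟨fun s hs t ht => h s hs t (Or.inl ht), fun s hs b hb => h s hs b (Or.inr hb)⟩
    · rintro ⟨h1, h2⟩ s hs z hz
      rcases hz with hz | hz
      exacts [h1 s hs z hz, h2 s hs z hz]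
  have eXY : {ω : BondConfig V | ∀ s ∈ S, ∀ z ∈ (T ∪ A) ∪ (T ∪ B), ω ∉ openConn s z} = D ∩ RA ∩ RB := by
    ext ω
    simp only [mem_setOf_eq, mem_inter_iff, mem_union, hD, hRA, hRB]
    constructor
    · intro h
      exact ⟨⟨fun s hs t ht => h s hs t (Or.inl (Or.inl ht)), fun s hs a ha => h s hs a (Or.inl (Or.inr ha))⟩,
        fun s hs b hb => h s hs b (Or.inr (Or.inr hb))⟩
    · rintro ⟨⟨h1, h2⟩, h3⟩ s hs z hz
      rcases hz with (hz | hz) | (hz | hz)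
      exacts [h1 s hs z hz, h2 s hs z hz, h1 s hs z hz, h3 s hs z hz]
  -- avoidance is antitone in the avoided set: `(T ∪ A) ∩ (T ∪ B) ⊇ T`
  have sub : {ω : BondConfig V | ∀ s ∈ S, ∀ z ∈ (T ∪ A) ∩ (T ∪ B), ω ∉ openConn s z} ⊆ D := by
    intro ω h s hs t ht
    exact h s hs t ⟨Or.inl ht, Or.inl ht⟩
  rw [eX, eY, eXY] at hBK
  -- the four numbers
  set d : ℝ := μ.real D with hd
  set px : ℝ := μ.real (D ∩ RA) with hpx
  set py : ℝ := μ.real (D ∩ RB) with hpy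
  set z : ℝ := μ.real (D ∩ RA ∩ RB) with hz
  have hmid : μ.real {ω : BondConfig V | ∀ s ∈ S, ∀ z ∈ (T ∪ A) ∩ (T ∪ B), ω ∉ openConn s z} ≤ d :=
    measureReal_mono sub (measure_ne_top μ _)
  have hz0 : 0 ≤ z := measureReal_nonneg
  have key : px * py ≤ d * z := hBK.trans (mul_le_mul_of_nonneg_right hmid hz0)
  -- inclusion–exclusion: the connection events are the complements of the avoidance events inside `D`
  have eA : {ω : BondConfig V | (∀ s ∈ S, ∀ t ∈ T, ω ∉ openConn s t) ∧ ∃ s ∈ S, ∃ a ∈ A, ω ∈ openConn s a} = D \ RA := by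
    ext ω
    simp only [mem_setOf_eq, mem_sdiff, hD, hRA, not_forall, not_not, exists_prop]
  have eB : {ω : BondConfig V | (∀ s ∈ S, ∀ t ∈ T, ω ∉ openConn s t) ∧ ∃ s ∈ S, ∃ b ∈ B, ω ∈ openConn s b} = D \ RB := by
    ext ω
    simp only [mem_setOf_eq, mem_sdiff, hD, hRB, not_forall, not_not, exists_prop]
  have eAB : {ω : BondConfig V | (∀ s ∈ S, ∀ t ∈ T, ω ∉ openConn s t) ∧ (∃ s ∈ S, ∃ a ∈ A, ω ∈ openConn s a) ∧
      ∃ s ∈ S, ∃ b ∈ B, ω ∈ openConn s b} = (D \ RA) \ RB := by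
    ext ω
    simp only [mem_setOf_eq, mem_sdiff, hD, hRA, hRB, not_forall, not_not, exists_prop, and_assoc]
  have mRA : MeasurableSet RA := MeasurableSet.of_discrete
  have mRB : MeasurableSet RB := MeasurableSet.of_discrete
  have i1 : μ.real (D ∩ RA) + μ.real (D \ RA) = μ.real D := measureReal_inter_add_sdiff (μ := μ) (s := D) mRA
  have i2 : μ.real (D ∩ RB) + μ.real (D \ RB) = μ.real D := measureReal_inter_add_sdiff (μ := μ) (s := D) mRB
  have i3 : μ.real ((D \ RA) ∩ RB) + μ.real ((D \ RA) \ RB) = μ.real (D \ RA) :=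
    measureReal_inter_add_sdiff (μ := μ) (s := D \ RA) mRB
  have e4 : (D \ RA) ∩ RB = (D ∩ RB) \ RA := by
    ext ω; simp only [mem_inter_iff, mem_sdiff]; tauto
  have i4 : μ.real ((D ∩ RB) ∩ RA) + μ.real ((D ∩ RB) \ RA) = μ.real (D ∩ RB) :=
    measureReal_inter_add_sdiff (μ := μ) (s := D ∩ RB) mRA
  have e5 : (D ∩ RB) ∩ RA = D ∩ RA ∩ RB := by
    ext ω; simp only [mem_inter_iff]; tauto
  rw [e5] at i4
  rw [e4] at i3
  have vA : μ.real (D \ RA) = d - px := by linarith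
  have vB : μ.real (D \ RB) = d - py := by linarith
  have vAB : μ.real ((D \ RA) \ RB) = d - px - py + z := by linarith
  rw [eA, eB, eAB, vA, vB, vAB]
  exact ie_step key

end Literature.Probability.Percolation.BergKahn

end
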